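import Summits.MatrixMultiplication.MatrixMultiplication.Theorems.ConeTensorCore
import HarnessLib

/-!
# ConeTensorSteepCore — the STEEP cones `W_{N,n} = T(K₄; spokes N², rim n)`, `N = n·q`: the tensor,
the apex-triangle cover `R₄(W_{N,n}) ≤ R(⟨N,n,N⟩)³`, the grouping `R(⟨N⁴, n², N²⟩) ≤ R₄(W_{N,n})`
and the flattening floor `N⁶ ≤ R₄(W_{N,n})`

(decomp-mm lens 6 «barrier-complement carving», gen 34; a Theorems kernel beneath the attacked leaf
`TetrahedronCarving.TetraExcessZero` (stmt-26697), filed `--as helper`. Companion `ConeTensorSteep`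
carries the exponent layer: the spoke pencil `ω_steep(k)` and its decided far end.)

THE OBJECT. For `N = n·q` the steep cone `W_{N,n} ∈ (F^{(N²)³})^{⊗4}` is the graph tensor
(Christandl–Vrana–Zuiddam, arXiv:1609.07476 [CVZ19], Ex. 1.1.2: one EPR pair per edge, non-uniform
dimensions) of the weighted tetrahedron with apex `0`, spokes `01, 02, 03` of bond `N²` and rim edges
`12, 13, 23` of bond `n` — DEFINED (`steep`) as the Kronecker product of the three rectangular matrix
multiplication tensors `⟨N, n, N⟩` placed on the apex triangles `{0,2,3}, {0,1,3}, {0,1,2}` (the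
`q = 1` member is the squared-spoke cone `W_n` of `ConeTensorCore`, up to the format relabelling
`n·1 = n`). It lives in the cubic `tensorRankD` format of side `(N·N)³` (three pair labels per leg, as
in `ConeTensorCore`); a rim label is the FIRST sub-component `rim : Fin (n·q) → Fin n` of the first
pair component, the other components being padding (a leg constant along padded coordinates changes
no rank bound below).

What is proved (every field; no `sorry`, no new axiom, no instance, no notation, no `Prop`-valued
definition): `steep_eq_sum_cover`, `tensorRankD_steep_le : R₄(W_{N,n}) ≤ R(⟨N,n,N⟩)³`,
`steep_decomposable`, `exists_rankOne_decomposition_steep`; `steep_groupLegs` (the grouped steep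
cone `{2,3} | 0 | 1` IS `⟨N⁴, n², N²⟩`), `tensorRank_matMulTensor_le_tensorRankD_steep :
R(⟨N⁴, n², N²⟩) ≤ R₄(W_{N,n})`, `pow_six_le_tensorRankD_steep : N⁶ ≤ R₄(W_{N,n})` (`n, q ≥ 1`).
-/

noncomputable section

-- D-0017 nested layout `Summits/<Summit>/<Sub>/…` with `Sub = Summit` duplicates a namespace component.
set_option linter.dupNamespace false

open scoped BigOperators
open Literature.Computability.AlgebraicComplexity
open Summit.MatrixMultiplication.MatrixMultiplication.Theorems.TetrahedronTensor

namespace Summit.MatrixMultiplication.MatrixMultiplication.Theorems.ConeTensor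

/-! ## The steep cone `W_{N,n}` (`N = n·q`) -/

section Tensor

variable (F : Type*) [Field F]

/-- The rim sub-label: the first component `Fin n` of a label component `Fin (n·q)`. -/
def rim {n q : ℕ} (y : Fin (n * q)) : Fin n :=
  (finProdFinEquiv.symm y).1

/-- **The steep cone** `W_{N,n} = ⟨N,n,N⟩_{023} ⊠ ⟨N,n,N⟩_{013} ⊠ ⟨N,n,N⟩_{012}` (`N = n·q`): the graph
tensor of `K₄` with spokes `01, 02, 03` of bond `N²` and rim edges `12, 13, 23` of bond `n`, in the
cubic 4-leg format of side `(N·N)³` (leg index = three pair labels `(P₁, P₂) ∈ [N]²`, slots ordered as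
in `TetrahedronTensor.tetra`: vertex `0 ↦ (01,02,03)`, `1 ↦ (01,12,13)`, `2 ↦ (02,12,23)`,
`3 ↦ (03,13,23)`; a spoke uses both pair components, one per apex triangle through it; a rim edge uses
only `rim ∘ P₁` of its slot). Same factor order and label routing as `ConeTensorCore.cone`.
(CVZ19, Ex. 1.1.2 and Prop. 1.1.16). -/
def steep (n q : ℕ) : (Fin 4 → Fin (((n * q) * (n * q)) ^ 3)) → F := fun i =>
  matMulTensor F (n * q) n (n * q) (P₂ (i 0) 1, P₂ (i 0) 2) (P₂ (i 2) 0, rim (P₁ (i 2) 2))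
      (rim (P₁ (i 3) 2), P₂ (i 3) 0) *
  matMulTensor F (n * q) n (n * q) (P₂ (i 0) 0, P₁ (i 0) 2) (P₂ (i 1) 0, rim (P₁ (i 1) 2))
      (rim (P₁ (i 3) 1), P₁ (i 3) 0) *
  matMulTensor F (n * q) n (n * q) (P₁ (i 0) 0, P₁ (i 0) 1) (P₁ (i 1) 0, rim (P₁ (i 1) 1))
      (rim (P₁ (i 2) 1), P₁ (i 2) 0)

variable {F}

/-! ## The apex-triangle cover `R₄(W_{N,n}) ≤ R(⟨N,n,N⟩)³` -/

/-- The four legs of the cover summand indexed by `l : Fin 3 → Fin r` (one index per apex triangle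
`{0,2,3}, {0,1,3}, {0,1,2}`), from a triad decomposition `⟨N,n,N⟩ = ∑_j w_j ⊗ u_j ⊗ v_j`.
(CVZ19, Prop. 1.1.16 (proof)). -/
def steepLeg {n q r : ℕ} (w : Fin r → Fin (n * q) × Fin (n * q) → F)
    (u : Fin r → Fin (n * q) × Fin n → F) (v : Fin r → Fin n × Fin (n * q) → F) (l : Fin 3 → Fin r) :
    Fin 4 → Fin (((n * q) * (n * q)) ^ 3) → F :=
  ![fun x => w (l 0) (P₂ x 1, P₂ x 2) * w (l 1) (P₂ x 0, P₁ x 2) * w (l 2) (P₁ x 0, P₁ x 1),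
    fun x => u (l 1) (P₂ x 0, rim (P₁ x 2)) * u (l 2) (P₁ x 0, rim (P₁ x 1)),
    fun x => u (l 0) (P₂ x 0, rim (P₁ x 2)) * v (l 2) (rim (P₁ x 1), P₁ x 0),
    fun x => v (l 0) (rim (P₁ x 2), P₂ x 0) * v (l 1) (rim (P₁ x 1), P₁ x 0)]

/-- **The cover decomposition of the steep cone**: from `⟨N,n,N⟩ = ∑_{j<r} w_j ⊗ u_j ⊗ v_j`,
`W_{N,n} = ∑_{l ∈ [r]^3} ⊗_v steepLeg_l(v)` (`r³` rank-one terms).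
[cite: ChristandlVranaZuiddam2016, Prop. 1.1.16 (proof)] -/
theorem steep_eq_sum_cover {n q r : ℕ} {w : Fin r → Fin (n * q) × Fin (n * q) → F}
    {u : Fin r → Fin (n * q) × Fin n → F} {v : Fin r → Fin n × Fin (n * q) → F}
    (hdec : matMulTensor F (n * q) n (n * q) = ∑ j, triad (w j) (u j) (v j)) :
    ∑ l : Fin 3 → Fin r, rankOneTensor (steepLeg w u v l) = steep F n q := by
  classical
  have hMM : ∀ a b c, matMulTensor F (n * q) n (n * q) a b c = ∑ j : Fin r, w j a * u j b * v j c := by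
    intro a b c
    have h := congrFun (congrFun (congrFun hdec a) b) c
    rw [h, Finset.sum_apply, Finset.sum_apply, Finset.sum_apply]
    rfl
  funext i
  -- the apex triangle terms at the point `i`
  let T : Fin 3 → Fin r → F := ![
    fun j => w j (P₂ (i 0) 1, P₂ (i 0) 2) * u j (P₂ (i 2) 0, rim (P₁ (i 2) 2)) *
      v j (rim (P₁ (i 3) 2), P₂ (i 3) 0),
    fun j => w j (P₂ (i 0) 0, P₁ (i 0) 2) * u j (P₂ (i 1) 0, rim (P₁ (i 1) 2)) *
      v j (rim (P₁ (i 3) 1), P₁ (i 3) 0),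
    fun j => w j (P₁ (i 0) 0, P₁ (i 0) 1) * u j (P₁ (i 1) 0, rim (P₁ (i 1) 1)) *
      v j (rim (P₁ (i 2) 1), P₁ (i 2) 0)]
  calc (∑ l : Fin 3 → Fin r, rankOneTensor (steepLeg w u v l)) i
      = ∑ l : Fin 3 → Fin r, ∏ t, T t (l t) := by
        rw [Finset.sum_apply]
        refine Finset.sum_congr rfl fun l _ => ?_
        rw [rankOneTensor_apply, Fin.prod_univ_four, Fin.prod_univ_three]
        simp only [steepLeg, T, Matrix.cons_val_zero, Matrix.cons_val_one, Matrix.cons_val_two,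
          Matrix.cons_val_three, Matrix.head_cons, Matrix.tail_cons]
        ring
    _ = ∏ t, ∑ j, T t j := (Fintype.prod_sum T).symm
    _ = steep F n q i := by
        rw [Fin.prod_univ_three]
        simp only [steep]
        rw [hMM, hMM, hMM]
        simp only [T, Matrix.cons_val_zero, Matrix.cons_val_one, Matrix.cons_val_two,
          Matrix.head_cons, Matrix.tail_cons]

/-- **Cover bound** `R₄(W_{N,n}) ≤ R(⟨N,n,N⟩)³` (rank is sub-multiplicative under the Kronecker
product of the three apex triangles). [cite: ChristandlVranaZuiddam2016, Prop. 1.1.16 (proof)] -/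
theorem tensorRankD_steep_le (n q : ℕ) :
    tensorRankD (steep F n q) ≤ tensorRank (matMulTensor F (n * q) n (n * q)) ^ 3 := by
  classical
  obtain ⟨w, u, v, hdec⟩ := exists_triad_decomposition_tensorRank (matMulTensor F (n * q) n (n * q))
  have hsum := steep_eq_sum_cover hdec
  have hcard : Fintype.card (Fin 3 → Fin (tensorRank (matMulTensor F (n * q) n (n * q)))) =
      tensorRank (matMulTensor F (n * q) n (n * q)) ^ 3 := by simp
  rw [← hcard]
  let e := Fintype.equivFin (Fin 3 → Fin (tensorRank (matMulTensor F (n * q) n (n * q))))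
  refine tensorRankD_le_of_eq_sum (fun k => steepLeg w u v (e.symm k)) ?_
  rw [← hsum]
  exact Fintype.sum_equiv e.symm _ _ (fun _ => rfl)

/-- `W_{N,n}` decomposes over rank-one tensors (so `tensorRankD (steep F n q)` is a genuine minimum).
[cite: ChristandlVranaZuiddam2016, Ex. 1.1.2] -/
theorem steep_decomposable (n q : ℕ) :
    ∃ s : ℕ, ∃ g : Fin s → ((Fin 4 → Fin (((n * q) * (n * q)) ^ 3)) → F),
      (∀ k, g k ∈ rankOneTensors F (((n * q) * (n * q)) ^ 3) 4) ∧ ∑ k, g k = steep F n q := by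
  classical
  obtain ⟨w, u, v, hdec⟩ := exists_triad_decomposition_tensorRank (matMulTensor F (n * q) n (n * q))
  let e := Fintype.equivFin (Fin 3 → Fin (tensorRank (matMulTensor F (n * q) n (n * q))))
  refine ⟨_, fun k => rankOneTensor (steepLeg w u v (e.symm k)), fun _ => rankOneTensor_mem _, ?_⟩
  rw [← steep_eq_sum_cover hdec]
  exact Fintype.sum_equiv e.symm _ _ (fun _ => rfl)

/-- A rank-one decomposition of `W_{N,n}` of length exactly `R₄(W_{N,n})`. [folklore] -/
theorem exists_rankOne_decomposition_steep (n q : ℕ) :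
    ∃ u : Fin (tensorRankD (steep F n q)) → Fin 4 → Fin (((n * q) * (n * q)) ^ 3) → F,
      ∑ k, rankOneTensor (u k) = steep F n q := by
  classical
  obtain ⟨g, hg, hs⟩ := sComplexity_spec (steep_decomposable (F := F) n q)
  simp only [rankOneTensors, Set.mem_range] at hg
  choose u hu using hg
  have h : ∑ k, rankOneTensor (u k) = ∑ k, g k := Finset.sum_congr rfl fun k _ => hu k
  exact ⟨u, h.trans hs⟩

end Tensor

/-! ## Grouping `{2,3} | 0 | 1`: `R(⟨N⁴, n², N²⟩) ≤ R₄(W_{N,n})` and the flattening `N⁶ ≤ R₄(W_{N,n})` -/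

section Grouping

variable {F : Type*} [Field F]

/-- The zero label component `(0,0) ∈ Fin (n·q)`. -/
def zN (n q : ℕ) [NeZero n] [NeZero q] : Fin (n * q) :=
  finProdFinEquiv ((0 : Fin n), (0 : Fin q))

/-- The frozen pair label `((0,0),(0,0)) ∈ Fin ((n·q)·(n·q))`. -/
def zNN (n q : ℕ) [NeZero n] [NeZero q] : Fin ((n * q) * (n * q)) :=
  finProdFinEquiv (zN n q, zN n q)

/-- A rim value `e ∈ Fin n` as a pair label whose first component has rim sub-label `e`
(all padding components `0`). -/
def rimLabel {n q : ℕ} [NeZero n] [NeZero q] (e : Fin n) : Fin ((n * q) * (n * q)) :=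
  finProdFinEquiv (finProdFinEquiv (e, (0 : Fin q)), zN n q)

/-- The rim sub-label of `rimLabel e` is `e`. -/
@[simp] theorem rim_rimLabel {n q : ℕ} [NeZero n] [NeZero q] (e : Fin n) :
    rim (finProdFinEquiv.symm (rimLabel (q := q) e)).1 = e := by
  simp [rim, rimLabel]

/-- Apex leg of the grouping: vertex `0` reads, off the point `a = (κ, ν)` of `⟨N⁴, n², N²⟩`
(`κ = (e₀₂, e₀₃)` two pair labels, `ν = e₀₁` a pair label), the slot triple `(e₀₁, e₀₂, e₀₃)`. -/
def sleg₀ {n q : ℕ} (a : Fin ((n * q) * (n * q) * ((n * q) * (n * q))) × Fin ((n * q) * (n * q))) :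
    Fin (((n * q) * (n * q)) ^ 3) :=
  enc a.2 (finProdFinEquiv.symm a.1).1 (finProdFinEquiv.symm a.1).2

/-- Leg of vertex `1`: off `c = (μ, ν)` (`μ = (e₁₂, e₁₃) ∈ [n]²`, `ν = e₀₁`), the triple
`(e₀₁, rimLabel e₁₂, rimLabel e₁₃)`. -/
def sleg₁ {n q : ℕ} [NeZero n] [NeZero q] (c : Fin (n * n) × Fin ((n * q) * (n * q))) :
    Fin (((n * q) * (n * q)) ^ 3) :=
  enc c.2 (rimLabel (finProdFinEquiv.symm c.1).1) (rimLabel (finProdFinEquiv.symm c.1).2)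

/-- Leg of vertex `2`: off `b = (κ', μ')`, the triple `(e₀₂, rimLabel e₁₂, frozen)` (rim edge `23`
frozen to the zero label). -/
def sleg₂ {n q : ℕ} [NeZero n] [NeZero q]
    (b : Fin ((n * q) * (n * q) * ((n * q) * (n * q))) × Fin (n * n)) :
    Fin (((n * q) * (n * q)) ^ 3) :=
  enc (finProdFinEquiv.symm b.1).1 (rimLabel (finProdFinEquiv.symm b.2).1) (zNN n q)

/-- Leg of vertex `3`: off `b = (κ', μ')`, the triple `(e₀₃, rimLabel e₁₃, frozen)`. -/
def sleg₃ {n q : ℕ} [NeZero n] [NeZero q]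
    (b : Fin ((n * q) * (n * q) * ((n * q) * (n * q))) × Fin (n * n)) :
    Fin (((n * q) * (n * q)) ^ 3) :=
  enc (finProdFinEquiv.symm b.1).2 (rimLabel (finProdFinEquiv.symm b.2).2) (zNN n q)

/-- The four legs of `W_{N,n}` read off a point `(a, b, c)` of `⟨N⁴, n², N²⟩` under the grouping
`{2,3} | 0 | 1` (party `0` = `(κ, ν)`, the group `{2,3}` = `(κ, μ)`, party `1` = `(μ, ν)`; spoke
`01 = ν ∈ [N²]`, spokes `(02, 03) = κ ∈ [N⁴]`, rim edges `(12, 13) = μ ∈ [n²]`, rim edge `23` frozen). -/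
def sgroupLegs {n q : ℕ} [NeZero n] [NeZero q]
    (a : Fin ((n * q) * (n * q) * ((n * q) * (n * q))) × Fin ((n * q) * (n * q)))
    (b : Fin ((n * q) * (n * q) * ((n * q) * (n * q))) × Fin (n * n))
    (c : Fin (n * n) × Fin ((n * q) * (n * q))) :
    Fin 4 → Fin (((n * q) * (n * q)) ^ 3) :=
  ![sleg₀ a, sleg₁ c, sleg₂ b, sleg₃ b]

/-- **The grouped steep cone is `⟨N⁴, n², N²⟩`**: at the legs `sgroupLegs a b c`, `W_{N,n}` takes the
value `⟨N⁴, n², N²⟩(a, b, c)`. [folklore] -/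
theorem steep_groupLegs {n q : ℕ} [NeZero n] [NeZero q]
    (a : Fin ((n * q) * (n * q) * ((n * q) * (n * q))) × Fin ((n * q) * (n * q)))
    (b : Fin ((n * q) * (n * q) * ((n * q) * (n * q))) × Fin (n * n))
    (c : Fin (n * n) × Fin ((n * q) * (n * q))) :
    steep F n q (sgroupLegs a b c) =
      matMulTensor F ((n * q) * (n * q) * ((n * q) * (n * q))) (n * n) ((n * q) * (n * q)) a b c := by
  have e : ∀ x y : Fin ((n * q) * (n * q)), x = y ↔
      ((finProdFinEquiv.symm x).1 = (finProdFinEquiv.symm y).1 ∧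
        (finProdFinEquiv.symm x).2 = (finProdFinEquiv.symm y).2) := fun x y => by
    rw [← Prod.ext_iff, Equiv.apply_eq_iff_eq]
  have e' : ∀ x y : Fin ((n * q) * (n * q) * ((n * q) * (n * q))), x = y ↔
      ((finProdFinEquiv.symm x).1 = (finProdFinEquiv.symm y).1 ∧
        (finProdFinEquiv.symm x).2 = (finProdFinEquiv.symm y).2) := fun x y => by
    rw [← Prod.ext_iff, Equiv.apply_eq_iff_eq]
  have e'' : ∀ x y : Fin (n * n), x = y ↔
      ((finProdFinEquiv.symm x).1 = (finProdFinEquiv.symm y).1 ∧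
        (finProdFinEquiv.symm x).2 = (finProdFinEquiv.symm y).2) := fun x y => by
    rw [← Prod.ext_iff, Equiv.apply_eq_iff_eq]
  simp only [steep, matMulTensor, ite_one_zero_mul_ite]
  refine if_congr ?_ rfl rfl
  simp only [sgroupLegs, sleg₀, sleg₁, sleg₂, sleg₃, rimLabel, rim, zNN, P₁, P₂, symm_enc,
    Equiv.symm_apply_apply, Matrix.cons_val_zero, Matrix.cons_val_one, Matrix.cons_val_two,
    Matrix.cons_val_three, Matrix.head_cons, Matrix.tail_cons, e' a.1 b.1, e a.2 c.2, e'' b.2 c.1,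
    e (finProdFinEquiv.symm a.1).1 (finProdFinEquiv.symm b.1).1,
    e (finProdFinEquiv.symm a.1).2 (finProdFinEquiv.symm b.1).2, true_and,
    @eq_comm _ (finProdFinEquiv.symm c.1).1 (finProdFinEquiv.symm b.2).1,
    @eq_comm _ (finProdFinEquiv.symm c.1).2 (finProdFinEquiv.symm b.2).2]
  tauto

/-- **Grouping lower-bound transfer** `R(⟨N⁴, n², N²⟩) ≤ R₄(W_{N,n})` (`n, q ≥ 1`): a rank-one
decomposition `W_{N,n} = ∑_k ⊗_v u_k(v)` restricts along `sgroupLegs` to a triad decomposition of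
`⟨N⁴, n², N²⟩`. [folklore] -/
theorem tensorRank_matMulTensor_le_tensorRankD_steep (n q : ℕ) [NeZero n] [NeZero q] :
    tensorRank (matMulTensor F ((n * q) * (n * q) * ((n * q) * (n * q))) (n * n) ((n * q) * (n * q)))
      ≤ tensorRankD (steep F n q) := by
  classical
  obtain ⟨u, hu⟩ := exists_rankOne_decomposition_steep (F := F) n q
  refine tensorRank_le_of_eq_sum (fun k a => u k 0 (sleg₀ a))
    (fun k b => u k 2 (sleg₂ b) * u k 3 (sleg₃ b)) (fun k c => u k 1 (sleg₁ c)) ?_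
  funext a b c
  have hpt := congrFun hu (sgroupLegs a b c)
  rw [Finset.sum_apply, steep_groupLegs] at hpt
  rw [← hpt, Finset.sum_apply, Finset.sum_apply, Finset.sum_apply]
  refine Finset.sum_congr rfl fun k _ => ?_
  rw [rankOneTensor_apply, Fin.prod_univ_four, triad_apply]
  simp only [sgroupLegs, Matrix.cons_val_zero, Matrix.cons_val_one, Matrix.cons_val_two,
    Matrix.cons_val_three, Matrix.head_cons, Matrix.tail_cons]
  ring

/-- **Flattening lower bound** `N⁶ ≤ R₄(W_{N,n})` for `n, q ≥ 1` (the apex cut `0 | 123` carries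
`(N²)³` EPR pairs; here: grouping + the flattening `k·n ≤ R(⟨k,m,n⟩)` of `⟨N⁴, n², N²⟩`).
[cite: ChristandlVranaZuiddam2016, §1.2 (eq. (flat))] -/
theorem pow_six_le_tensorRankD_steep (n q : ℕ) [NeZero n] [NeZero q] :
    (n * q) ^ 6 ≤ tensorRankD (steep F n q) := by
  haveI : NeZero (n * n) := ⟨mul_ne_zero (NeZero.ne n) (NeZero.ne n)⟩
  calc (n * q) ^ 6 = (n * q) * (n * q) * ((n * q) * (n * q)) * ((n * q) * (n * q)) := by ring
    _ ≤ tensorRank (matMulTensor F ((n * q) * (n * q) * ((n * q) * (n * q))) (n * n)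
          ((n * q) * (n * q))) := mul_le_tensorRank_matMulTensor F _ _ _
    _ ≤ tensorRankD (steep F n q) := tensorRank_matMulTensor_le_tensorRankD_steep n q

end Grouping

end Summit.MatrixMultiplication.MatrixMultiplication.Theorems.ConeTensor

end
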